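import Summits.SmoothPoincare4.SmoothPoincare4.Theorems.CylinderEntropyCylinderRungTwoFluxIdentityMultiplicity
import HarnessLib

/-!
# Route `CylinderEntropy`, item `ImmortalAreaToFloor` (stmt-SmoothPoincare4-17197):
# the mass of a DOUBLE LAYER — two fibre points over each column of `P` carry twice the shadow mass of `P`

Brick (DT, assembly half) of the Allard-free blueprint for the residual `ThinSeq` of the item (evidence
`ANALYSIS-prover-17197-c1.md`, §6, CASE 0 of the per-ball lemma).  For a closed embedded cross-section
`ι : M → N = S⁴ × ℝ ⊂ ℝ⁶` with continuous unit normal `ν` tangent to `N`, a weight `K ≥ 0` on `ℝ⁶` (meant: the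
typed cylinder kernel `cylKernel p τ`), a weight `m ≥ 0` on the shadow sphere (meant: the chordal Gaussian minorant
of `…KernelChordal.lean` times the vertical factor) and a measurable set `P` of columns such that over EVERY `q ∈ P`
there are two distinct regular fibre points (`truncL (ι x₁) = truncL (ι x₂) = q`, `ν₅ ≠ 0`) with `K ≥ m q`:

* **`two_mul_lintegral_le_lintegral_range_of_doubleLayer`** —
  `2 ∫⁻_P m dμHE[4] ≤ ∫⁻_{ι(M)} K dμHE[4]`.

Proof: layer cake on both sides (`lintegral_eq_lintegral_meas_lt`); at level `t`, the regular piece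
`P_t = {x | t < K(ι x), ν₅ x ≠ 0}` has at least two points over every `q ∈ P ∩ {t < m}`, so
`2 μHE(P ∩ {t < m}) ≤ ∫ #(shadow⁻¹{q} ∩ P_t) dμHE = ∫_{P_t} |ν₅| d(ι^*μHE) ≤ (ι^*μHE)(P_t) ≤ μHE(ι(M) ∩ {t < K})` by the
landed MULTIPLICITY AREA FORMULA `lintegral_abs_nu5_eq_lintegral_encard` (no weighted area formula is needed).
Everything is proved; no definition, no named fact.

References: H. Federer, *Geometric Measure Theory* (1969), 3.2.3 (area formula with multiplicities); layer-cake
formula (E. H. Lieb, M. Loss, *Analysis*, Thm. 1.13).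
-/

-- the prescribed namespace `Summit.SmoothPoincare4.SmoothPoincare4.…` repeats `SmoothPoincare4`
set_option linter.dupNamespace false

noncomputable section

open MeasureTheory Set Function Filter Module
open scoped Manifold ContDiff ENNReal Topology RealInnerProductSpace NNReal

namespace Summit.SmoothPoincare4.SmoothPoincare4.Theorems.CylinderRungTwo.KillingFlux

open Literature.Geometry.Riemannian
open Literature.Geometry.Lorentzian Literature.Geometry.Lorentzian.PseudoRiemannianMetric
open Literature.Geometry.Riemannian.SphericalCylinderEntropy (truncL)
open Literature.Geometry.GeometricMeasureTheory

variable {M : Type} [TopologicalSpace M] [ChartedSpace (EuclideanSpace ℝ (Fin 4)) M] [IsManifold (𝓡 4) ∞ M]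
  [CompactSpace M] [MeasurableSpace M] [BorelSpace M] [SecondCountableTopology M] [Nonempty M]

/-- **Mass of a double layer.** For a closed embedded cross-section `ι : M → N ⊂ ℝ⁶` with continuous unit normal
`ν` tangent to `N`, measurable weights `K ≥ 0` on `ℝ⁶` and `m ≥ 0` on `ℝ⁵`, and a measurable set `P ⊆ ℝ⁵` of
columns over each of which there are two distinct regular fibre points (`truncL (ι x₁) = truncL (ι x₂) = q`,
`ν x₁ 5 ≠ 0 ≠ ν x₂ 5`) with `m q ≤ K (ι x₁), K (ι x₂)`: `2 ∫⁻_P m dμHE[4] ≤ ∫⁻_{ι(M)} K dμHE[4]`.  Layer cake on both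
sides, and at each level the landed multiplicity area formula `lintegral_abs_nu5_eq_lintegral_encard` for the
regular piece `{t < K ∘ ι} ∩ {ν₅ ≠ 0}`. [cite: Federer1969, 3.2.3] -/
theorem two_mul_lintegral_le_lintegral_range_of_doubleLayer {ι ν : M → (EuclideanSpace ℝ (Fin 6))}
    (hι : Manifold.IsSmoothEmbedding (𝓡 4) (𝓡 6) ∞ ι)
    (hιN : ∀ x, ∑ i : Fin 5, ι x (Fin.castSucc i) ^ 2 = 1)
    (hνc : Continuous ν) (hνn : (euclideanMetric (EuclideanSpace ℝ (Fin 6))).IsUnitNormal (𝓡 4) ι ν 1)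
    (hνt : ∀ x, ∑ i : Fin 5, ν x (Fin.castSucc i) * ι x (Fin.castSucc i) = 0)
    {K : EuclideanSpace ℝ (Fin 6) → ℝ} (hK : Measurable K) (hK0 : ∀ z, 0 ≤ K z)
    {m : EuclideanSpace ℝ (Fin 5) → ℝ} (hm : Measurable m) (hm0 : ∀ q, 0 ≤ m q)
    {P : Set (EuclideanSpace ℝ (Fin 5))} (hP : MeasurableSet P)
    (hlayer : ∀ q ∈ P, ∃ x₁ x₂ : M, x₁ ≠ x₂ ∧ truncL (ι x₁) = q ∧ truncL (ι x₂) = q ∧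
      ν x₁ 5 ≠ 0 ∧ ν x₂ 5 ≠ 0 ∧ m q ≤ K (ι x₁) ∧ m q ≤ K (ι x₂)) :
    2 * ∫⁻ q in P, ENNReal.ofReal (m q) ∂(μHE[4] : Measure (EuclideanSpace ℝ (Fin 5))) ≤
      ∫⁻ z in Set.range ι, ENNReal.ofReal (K z) ∂(μHE[4] : Measure (EuclideanSpace ℝ (Fin 6))) := by
  classical
  set σ : M → EuclideanSpace ℝ (Fin 5) := fun x => truncL (ι x) with hσ
  have hιc : Continuous ι := hι.contMDiff.continuous
  have hinj : Injective ι := hι.isEmbedding.injective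
  have hme : MeasurableEmbedding ι := (hιc.isClosedEmbedding hinj).measurableEmbedding
  have h5c : Continuous fun x => ν x 5 := (EuclideanSpace.proj (5 : Fin 6)).continuous.comp hνc
  have hmlev : ∀ t : ℝ, MeasurableSet {q : EuclideanSpace ℝ (Fin 5) | t < m q} := fun t =>
    measurableSet_lt measurable_const hm
  have hKlev : ∀ t : ℝ, MeasurableSet {z : EuclideanSpace ℝ (Fin 6) | t < K z} := fun t =>
    measurableSet_lt measurable_const hK
  -- layer cake on both sides
  rw [lintegral_eq_lintegral_meas_lt _ (Eventually.of_forall hm0) hm.aemeasurable,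
    lintegral_eq_lintegral_meas_lt _ (Eventually.of_forall fun z => hK0 z) hK.aemeasurable,
    ← lintegral_const_mul _ ?_]
  swap
  · exact Antitone.measurable (fun s t hst => measure_mono fun q (hq : t < _) => lt_of_le_of_lt hst hq)
  refine lintegral_mono fun t => ?_
  rw [Measure.restrict_apply (hmlev t), Measure.restrict_apply (hKlev t)]
  -- the regular piece at level `t`
  set Pt : Set M := {x | t < K (ι x)} ∩ {x | ν x 5 ≠ 0} with hPt
  have hPtm : MeasurableSet Pt :=
    (measurableSet_lt measurable_const (hK.comp hιc.measurable)).inter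
      ((measurableSet_singleton (0 : ℝ)).preimage h5c.measurable).compl
  obtain ⟨hmeas, hform⟩ :=
    lintegral_abs_nu5_eq_lintegral_encard hι hιN hνc hνn hνt hPtm (inter_subset_right)
  -- (a) two regular fibre points over every column of `P ∩ {t < m}`
  have ha : 2 * (μHE[4] : Measure (EuclideanSpace ℝ (Fin 5))) ({q | t < m q} ∩ P) ≤
      ∫⁻ q, (((fun x => truncL (ι x)) ⁻¹' {q} ∩ Pt).encard : ℝ≥0∞)
        ∂(μHE[4] : Measure (EuclideanSpace ℝ (Fin 5))) := by
    rw [← lintegral_indicator_const ((hmlev t).inter hP) 2]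
    refine lintegral_mono fun q => ?_
    by_cases hq : q ∈ {q | t < m q} ∩ P
    · rw [indicator_of_mem hq]
      obtain ⟨x₁, x₂, hne, h1, h2, hν1, hν2, hm1, hm2⟩ := hlayer q hq.2
      have hsub : ({x₁, x₂} : Set M) ⊆ (fun x => truncL (ι x)) ⁻¹' {q} ∩ Pt := by
        intro x hx
        rcases hx with rfl | rfl
        · exact ⟨h1, lt_of_lt_of_le hq.1 hm1, hν1⟩
        · exact ⟨h2, lt_of_lt_of_le hq.1 hm2, hν2⟩
      calc (2 : ℝ≥0∞) = ((({x₁, x₂} : Set M).encard : ℕ∞) : ℝ≥0∞) := by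
            rw [Set.encard_pair hne]; simp
        _ ≤ _ := ENat.toENNReal_le.2 (Set.encard_le_encard hsub)
    · rw [indicator_of_notMem hq]
      exact bot_le
  -- (b) the multiplicity formula and `|ν₅| ≤ 1`
  have hν5 : ∀ x, ENNReal.ofReal |ν x 5| ≤ 1 := fun x => by
    rw [← ENNReal.ofReal_one]
    refine ENNReal.ofReal_le_ofReal ?_
    have h1 : |ν x 5| = ‖ν x 5‖ := (Real.norm_eq_abs _).symm
    rw [h1, ← norm_nu hνn x]
    exact PiLp.norm_apply_le (ν x) 5
  have hb : ∫⁻ x in Pt, ENNReal.ofReal |ν x 5|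
        ∂(Measure.comap ι (μHE[4] : Measure (EuclideanSpace ℝ (Fin 6)))) ≤
      (μHE[4] : Measure (EuclideanSpace ℝ (Fin 6))) ({z | t < K z} ∩ Set.range ι) := by
    calc ∫⁻ x in Pt, ENNReal.ofReal |ν x 5| ∂(Measure.comap ι (μHE[4] : Measure (EuclideanSpace ℝ (Fin 6))))
        ≤ ∫⁻ _ in Pt, 1 ∂(Measure.comap ι (μHE[4] : Measure (EuclideanSpace ℝ (Fin 6)))) :=
          lintegral_mono fun x => hν5 x
      _ = (Measure.comap ι (μHE[4] : Measure (EuclideanSpace ℝ (Fin 6)))) Pt := setLIntegral_one _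
      _ = (μHE[4] : Measure (EuclideanSpace ℝ (Fin 6))) (ι '' Pt) := hme.comap_apply _ _
      _ ≤ (μHE[4] : Measure (EuclideanSpace ℝ (Fin 6))) ({z | t < K z} ∩ Set.range ι) := by
          refine measure_mono ?_
          rintro _ ⟨x, hx, rfl⟩
          exact ⟨hx.1, mem_range_self x⟩
  calc 2 * (μHE[4] : Measure (EuclideanSpace ℝ (Fin 5))) ({q | t < m q} ∩ P)
      ≤ ∫⁻ q, (((fun x => truncL (ι x)) ⁻¹' {q} ∩ Pt).encard : ℝ≥0∞)
          ∂(μHE[4] : Measure (EuclideanSpace ℝ (Fin 5))) := ha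
    _ = ∫⁻ x in Pt, ENNReal.ofReal |ν x 5| ∂(Measure.comap ι (μHE[4] : Measure (EuclideanSpace ℝ (Fin 6)))) :=
        hform.symm
    _ ≤ (μHE[4] : Measure (EuclideanSpace ℝ (Fin 6))) ({z | t < K z} ∩ Set.range ι) := hb

end Summit.SmoothPoincare4.SmoothPoincare4.Theorems.CylinderRungTwo.KillingFlux

end
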